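import Summits.CriticalPhenomena.SAWScalingLimit.Theorems.SAWReversalUpgradePathUpgradeRSLEBd
import Summits.CriticalPhenomena.SAWScalingLimit.Theorems.SAWReversalUpgradePathUpgradeRSLECont
import Summits.CriticalPhenomena.SAWScalingLimit.Theorems.SAWReversalUpgradePathUpgradeRSLEInj
import Summits.CriticalPhenomena.SAWScalingLimit.Theorems.SAWReversalUpgradePathUpgradeRSLEPor
import Summits.CriticalPhenomena.SAWScalingLimit.Theorems.SAWReversalUpgradePathUpgradeRSLEHeight
import Summits.CriticalPhenomena.SAWScalingLimit.Theorems.SAWReversalUpgradePathUpgradeRGate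
import Literature.Probability.RandomPlanarGeometry.ChordalReversibility
import HarnessLib

/-!
# Assembly phase `phase2a_coarse` — coarse constants of the two-sided window cascade
(crux `PathUpgradeR`, stmt-CriticalPhenomena-18055, route `SAWReversalUpgrade`,
line `bidir_windows`)

Landing target:
`Summits/CriticalPhenomena/SAWScalingLimit/Theorems/SAWReversalUpgradePathUpgradeRAsmCoarse.lean`
(`--supports stmt-CriticalPhenomena-18055`; registered anchor `stub_returnsDie_domainBall`,
assembly phase `PathUpgradeRAsm.phase2a_coarse` consumed positionally by the lead's final assembly
of `stub_returnsDie`).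

Given a Dobrushin domain `D` with forward uniformizer `φ : ℍ ≃ D` and backward uniformizer
`φ' : ℍ ≃ D.swap`, horizons `T, T' > 0`, the radii `ℓ, rbP, rbW ≤ rbP / 2, raP`, the start
windows `α₀, α₀'` and a budget `β > 0`, the phase theorem produces the coarse constants
`dB dB' c c₀ μ₀ c' c₁ μ₀' dS d' h₀q d'' h₀q' Rout Rout' r₁ r₁'` of the cascade together with
their order relations, the two uniform Wolff gates (forward for `φ`, backward for `φ'`) and nine
SLE(8/3) quantile bounds, each LITERALLY an instance of an already-landed quantile lemma:

* `dB, dB'` from `stub_sleBd` (boundary distance on `[α₀/2, T+1]`, resp. `[α₀'/2, T'+1]`);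
* `c` from `stub_sleCont` at oscillation `ℓ/2`; `c₀ := min (c/10) (1/16)`;
* `μ₀` from `stub_sleInj` at separation `c₀/4`; `c'` from `stub_sleCont` (backward) at `μ₀/2`;
  `c₁ := min c' (1/16)`; `μ₀'` from `stub_sleInj` (backward) at `c₁/4`;
* `dS := min (min (min dB dB') (min μ₀ μ₀')) (min raP rbP) / 16`; `d'` from `stub_slePor` at `dS`;
* `h₀q` from `stub_sleHeight` at `d'`; `d'' := min d' (rbP - rbW) / 4`; `h₀q'` from `stub_sleHeight`
  (backward) at `d''`;
* `Rout := min (h₀q/4) (1/64)`, `Rout' := min (h₀q'/4) (1/64)`; the gates `r₁, r₁'` from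
  `stub_gate` at `(M, μ₀/4, Rout)` and `(M, μ₀'/4, Rout')`, where `D ⊆ B(c, M)` is the anchor
  `stub_returnsDie_domainBall` (a Jordan domain is bounded).

No new mathematics: `obtain`s, `min`-choices and `min_le_left/right`, `div_le_div_of_nonneg_right`.
-/

noncomputable section

open scoped ENNReal NNReal
open Set Metric
open Literature.Probability Literature.Probability.RandomPlanarGeometry

namespace Summit.CriticalPhenomena.SAWScalingLimit.Theorems

/-- **Anchor `stub_returnsDie_domainBall`.** Every Dobrushin domain is contained in a ball of
positive radius: its carrier is a bounded Jordan domain (`JordanDomain.isBounded`), and a bounded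
set lies in a ball of radius `> 0` about any centre (`Bornology.IsBounded.subset_ball_lt`).
[folklore] -/
theorem stub_returnsDie_domainBall : ∀ D : Literature.Probability.RandomPlanarGeometry.DobrushinDomain, ∃ (c : ℂ) (M : ℝ), 0 < M ∧ D.carrier ⊆ Metric.ball c M := by
  intro D
  obtain ⟨M, hM, hDM⟩ := D.isBounded.subset_ball_lt 0 (0 : ℂ)
  exact ⟨0, M, hM, hDM⟩

namespace PathUpgradeRAsm

/-- **Assembly phase 2a (coarse constants).** For `D, φ, φ', T, T', ℓ, rbP, rbW, raP, α₀, α₀', β`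
as in the module docstring, the seventeen coarse constants of the `bidir_windows` cascade exist with
their order relations, the forward/backward uniform Wolff gates (`stub_gate` through the anchor
`stub_returnsDie_domainBall`) and the nine SLE(8/3) quantile bounds (`stub_sleBd`, `stub_sleCont`,
`stub_sleInj`, `stub_slePor`, `stub_sleHeight`, forward for `(D, φ)` and backward for
`(D.swap, φ')`), each of `P'`-measure at most `β`. [folklore] -/
theorem phase2a_coarse : ∀ (D : Literature.Probability.RandomPlanarGeometry.DobrushinDomain) (φ : Literature.Probability.RandomPlanarGeometry.ConformalEquiv UpperHalfPlane.upperHalfPlaneSet D.carrier), D.IsChordalUniformizing φ → ∀ (φ' : Literature.Probability.RandomPlanarGeometry.ConformalEquiv UpperHalfPlane.upperHalfPlaneSet D.swap.carrier), D.swap.IsChordalUniformizing φ' → ∀ (T T' : NNReal), 0 < T → 0 < T' → ∀ (ℓ rbP rbW raP α₀ α₀' : ℝ), 0 < ℓ → 0 < rbP → 0 < rbW → rbW ≤ rbP / 2 → 0 < raP → 0 < α₀ → 0 < α₀' → ∀ β : ENNReal, 0 < β → ∃ (dB dB' c c₀ μ₀ c' c₁ μ₀' dS d' h₀q d'' h₀q'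 Rout Rout' r₁ r₁' : ℝ), (0 < dB) ∧ (0 < dB') ∧ (0 < c) ∧ (0 < c₀) ∧ (c₀ ≤ c / 10) ∧ (c₀ ≤ 1 / 16) ∧ (0 < μ₀) ∧ (0 < c') ∧ (0 < c₁) ∧ (c₁ ≤ c') ∧ (c₁ ≤ 1 / 16) ∧ (0 < μ₀') ∧ (0 < dS) ∧ (dS ≤ dB / 16) ∧ (dS ≤ dB' / 16) ∧ (dS ≤ μ₀ / 16) ∧ (dS ≤ μ₀' / 16) ∧ (dS ≤ raP / 16) ∧ (dS ≤ rbP / 16) ∧ (0 < d') ∧ (0 < h₀q) ∧ (0 < d'') ∧ (d'' ≤ d' / 4) ∧ (d'' ≤ (rbP - rbW) / 4) ∧ (0 < h₀q') ∧ (0 < Rout) ∧ (Rout ≤ h₀q / 4) ∧ (Rout ≤ 1 / 64) ∧ (0 < Rout') ∧ (Rout' ≤ h₀q' / 4) ∧ (Rout' ≤ 1 / 64) ∧ (0 < r₁) ∧ (0 < r₁') ∧ ((∀ (V : NNReal → ℝ), Continuous V → ∀ t₁ : NNReal, ∃ C P Q : Set ℂ,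
   (∀ p ∈ C, ∀ q ∈ C, dist p q ≤ μ₀ / 4) ∧ Disjoint P Q ∧ Disjoint P C ∧ Disjoint Q C ∧
   P ∪ Q ∪ C = φ '' (Literature.Probability.RandomPlanarGeometry.Loewner.domain V t₁) ∧
   (∀ S : Set ℂ, IsPreconnected S → S ⊆ P ∪ Q → S ⊆ P ∨ S ⊆ Q) ∧
   (∀ y : ℂ, 0 < y.im → dist y (V t₁) ≤ r₁ → φ (Literature.Probability.RandomPlanarGeometry.Loewner.loewnerInv V t₁ y) ∈ P) ∧
   (∀ y : ℂ, 0 < y.im → Rout ≤ dist y (V t₁) → φ (Literature.Probability.RandomPlanarGeometry.Loewner.loewnerInv V t₁ y) ∈ Q))) ∧ ((∀ (V : NNReal → ℝ), Continuous V → ∀ t₁ : NNReal, ∃ C P Q : Set ℂ,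
   (∀ p ∈ C, ∀ q ∈ C, dist p q ≤ μ₀' / 4) ∧ Disjoint P Q ∧ Disjoint P C ∧ Disjoint Q C ∧
   P ∪ Q ∪ C = φ' '' (Literature.Probability.RandomPlanarGeometry.Loewner.domain V t₁) ∧
   (∀ S : Set ℂ, IsPreconnected S → S ⊆ P ∪ Q → S ⊆ P ∨ S ⊆ Q) ∧
   (∀ y : ℂ, 0 < y.im → dist y (V t₁) ≤ r₁' → φ' (Literature.Probability.RandomPlanarGeometry.Loewner.loewnerInv V t₁ y) ∈ P) ∧
   (∀ y : ℂ, 0 < y.im → Rout' ≤ dist y (V t₁) → φ' (Literature.Probability.RandomPlanarGeometry.Loewner.loewnerInv V t₁ y) ∈ Q))) ∧ (Literature.Probability.Process.preWienerMeasure {ω | ∃ u : NNReal, α₀ / 2 ≤ (u : ℝ) ∧ (u : ℝ) ≤ T + 1 ∧ Metric.infDist (φ.boundaryExtension (Literature.Probability.RandomPlanarGeometry.sleTrace ((8:NNReal)/3) ω u)) (frontier D.carrier) < dB} ≤ β) ∧ (Literature.Probability.Process.preWienerMeasure {ω | ∃ s t : NNReal, (s : ℝ) ≤ T + 1 ∧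 (t : ℝ) ≤ T + 1 ∧ |(s : ℝ) - t| ≤ c ∧ ℓ / 2 ≤ dist (φ.boundaryExtension (Literature.Probability.RandomPlanarGeometry.sleTrace ((8:NNReal)/3) ω s)) (φ.boundaryExtension (Literature.Probability.RandomPlanarGeometry.sleTrace ((8:NNReal)/3) ω t))} ≤ β) ∧ (Literature.Probability.Process.preWienerMeasure {ω | ∃ s t : NNReal, (s : ℝ) ≤ T + 1 ∧ (t : ℝ) ≤ T + 1 ∧ c₀ / 4 ≤ |(s : ℝ) - t| ∧ dist (φ.boundaryExtension (Literature.Probability.RandomPlanarGeometry.sleTrace ((8:NNReal)/3) ω s)) (φ.boundaryExtension (Literature.Probability.RandomPlanarGeometry.sleTrace ((8:NNReal)/3) ω t)) < μ₀} ≤ β) ∧ (Literature.Probability.Process.preWienerMeasure {ω | ∃ u : NNReal, (u : ℝ) ≤ T + 1 ∧ ∀ e ∈ D.carrier, dist e (φ.boundaryExtension (Literature.Probability.RandomPlanarGeometry.sleTrace ((8:NNReal)/3) ω u)) ≤ dS → Metric.infDist e ((fun v => φ.boundaryExtension (Literature.Probability.RandomPlanarGeometry.sleTrace ((8:NNReal)/3)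 ω v)) '' Set.Icc 0 (T + 1) ∪ frontier D.carrier) < d'} ≤ β) ∧ (Literature.Probability.Process.preWienerMeasure {ω | ∃ e ∈ D.carrier, d' ≤ Metric.infDist e ((fun v => φ.boundaryExtension (Literature.Probability.RandomPlanarGeometry.sleTrace ((8:NNReal)/3) ω v)) '' Set.Icc 0 (T + 1) ∪ frontier D.carrier) ∧ ¬ (((T : NNReal) : WithTop NNReal) < Literature.Probability.RandomPlanarGeometry.Loewner.swallowingTime (Literature.Probability.RandomPlanarGeometry.sleDriving ((8:NNReal)/3) ω) (φ.symm e) ∧ h₀q ≤ (Literature.Probability.RandomPlanarGeometry.Loewner.map (Literature.Probability.RandomPlanarGeometry.sleDriving ((8:NNReal)/3) ω) T (φ.symm e)).im)} ≤ β) ∧ (Literature.Probability.Process.preWienerMeasure {ω | ∃ u : NNReal, α₀' / 2 ≤ (u : ℝ) ∧ (u : ℝ) ≤ T' + 1 ∧ Metric.infDist (φ'.boundaryExtension (Literature.Probability.RandomPlanarGeometry.sleTrace ((8:NNReal)/3) ω u)) (frontier D.swap.carrier) < dB'} ≤ β) ∧ (Literature.Probability.Process.preWienerMeasure {ω | ∃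 s t : NNReal, (s : ℝ) ≤ T' + 1 ∧ (t : ℝ) ≤ T' + 1 ∧ |(s : ℝ) - t| ≤ c' ∧ μ₀ / 2 ≤ dist (φ'.boundaryExtension (Literature.Probability.RandomPlanarGeometry.sleTrace ((8:NNReal)/3) ω s)) (φ'.boundaryExtension (Literature.Probability.RandomPlanarGeometry.sleTrace ((8:NNReal)/3) ω t))} ≤ β) ∧ (Literature.Probability.Process.preWienerMeasure {ω | ∃ s t : NNReal, (s : ℝ) ≤ T' + 1 ∧ (t : ℝ) ≤ T' + 1 ∧ c₁ / 4 ≤ |(s : ℝ) - t| ∧ dist (φ'.boundaryExtension (Literature.Probability.RandomPlanarGeometry.sleTrace ((8:NNReal)/3) ω s)) (φ'.boundaryExtension (Literature.Probability.RandomPlanarGeometry.sleTrace ((8:NNReal)/3) ω t)) < μ₀'} ≤ β) ∧ (Literature.Probability.Process.preWienerMeasure {ω | ∃ e ∈ D.swap.carrier, d'' ≤ Metric.infDist e ((fun v => φ'.boundaryExtension (Literature.Probability.RandomPlanarGeometry.sleTrace ((8:NNReal)/3) ω v)) '' Set.Icc 0 (T' + 1) ∪ frontier D.swap.carrier) ∧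 ¬ (((T' : NNReal) : WithTop NNReal) < Literature.Probability.RandomPlanarGeometry.Loewner.swallowingTime (Literature.Probability.RandomPlanarGeometry.sleDriving ((8:NNReal)/3) ω) (φ'.symm e) ∧ h₀q' ≤ (Literature.Probability.RandomPlanarGeometry.Loewner.map (Literature.Probability.RandomPlanarGeometry.sleDriving ((8:NNReal)/3) ω) T' (φ'.symm e)).im)} ≤ β) := by
  intro D φ hφ φ' hφ' T T' hT hT' ℓ rbP rbW raP α₀ α₀' hℓ hrbP hrbW hrbW2 hraP hα₀ hα₀' β hβ
  -- boundary distances (forward and backward)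
  obtain ⟨dB, hdB, hBd⟩ := stub_sleBd D φ hφ T (α₀ / 2) (by positivity) β hβ
  obtain ⟨dB', hdB', hBd'⟩ := stub_sleBd D.swap φ' hφ' T' (α₀' / 2) (by positivity) β hβ
  -- modulus of continuity at oscillation `ℓ / 2`, then `c₀`
  obtain ⟨c, hc, hCont⟩ := stub_sleCont D φ hφ T (ℓ / 2) (by positivity) β hβ
  obtain ⟨c₀, hc₀eq⟩ : ∃ c₀ : ℝ, c₀ = min (c / 10) (1 / 16) := ⟨_, rfl⟩
  have hc₀ : 0 < c₀ := hc₀eq ▸ lt_min (by positivity) (by norm_num)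
  -- injectivity modulus at separation `c₀ / 4`
  obtain ⟨μ₀, hμ₀, hInj⟩ := stub_sleInj D φ hφ T (c₀ / 4) (by positivity) β hβ
  -- backward continuity at oscillation `μ₀ / 2`, then `c₁` and the backward injectivity modulus
  obtain ⟨c', hc', hCont'⟩ := stub_sleCont D.swap φ' hφ' T' (μ₀ / 2) (by positivity) β hβ
  obtain ⟨c₁, hc₁eq⟩ : ∃ c₁ : ℝ, c₁ = min c' (1 / 16) := ⟨_, rfl⟩
  have hc₁ : 0 < c₁ := hc₁eq ▸ lt_min hc' (by norm_num)
  obtain ⟨μ₀', hμ₀', hInj'⟩ := stub_sleInj D.swap φ' hφ' T' (c₁ / 4) (by positivity) β hβ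
  -- the shadow radius `dS`
  obtain ⟨m, hmeq⟩ : ∃ m : ℝ, m = min (min (min dB dB') (min μ₀ μ₀')) (min raP rbP) := ⟨_, rfl⟩
  have hm : 0 < m :=
    hmeq ▸ lt_min (lt_min (lt_min hdB hdB') (lt_min hμ₀ hμ₀')) (lt_min hraP hrbP)
  have hmdB : m ≤ dB := hmeq ▸ (min_le_left _ _).trans ((min_le_left _ _).trans (min_le_left _ _))
  have hmdB' : m ≤ dB' :=
    hmeq ▸ (min_le_left _ _).trans ((min_le_left _ _).trans (min_le_right _ _))
  have hmμ₀ : m ≤ μ₀ := hmeq ▸ (min_le_left _ _).trans ((min_le_right _ _).trans (min_le_left _ _))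
  have hmμ₀' : m ≤ μ₀' :=
    hmeq ▸ (min_le_left _ _).trans ((min_le_right _ _).trans (min_le_right _ _))
  have hmraP : m ≤ raP := hmeq ▸ (min_le_right _ _).trans (min_le_left _ _)
  have hmrbP : m ≤ rbP := hmeq ▸ (min_le_right _ _).trans (min_le_right _ _)
  obtain ⟨dS, hdSeq⟩ : ∃ dS : ℝ, dS = m / 16 := ⟨_, rfl⟩
  have hdS : 0 < dS := hdSeq ▸ by positivity
  have h16 : (0 : ℝ) ≤ 16 := by norm_num
  -- porosity scale `d'`, forward height `h₀q`, `d''`, backward height `h₀q'`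
  obtain ⟨d', hd', hPor⟩ := stub_slePor D φ hφ T dS hdS β hβ
  obtain ⟨h₀q, hh₀q, hHt⟩ := stub_sleHeight D φ hφ T hT d' hd' β hβ
  have hgap : 0 < rbP - rbW := by linarith
  obtain ⟨d'', hd''eq⟩ : ∃ d'' : ℝ, d'' = min d' (rbP - rbW) / 4 := ⟨_, rfl⟩
  have hd'' : 0 < d'' := hd''eq ▸ div_pos (lt_min hd' hgap) four_pos
  obtain ⟨h₀q', hh₀q', hHt'⟩ := stub_sleHeight D.swap φ' hφ' T' hT' d'' hd'' β hβ
  -- outer gate radii and the two uniform Wolff gates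
  obtain ⟨Rout, hRouteq⟩ : ∃ Rout : ℝ, Rout = min (h₀q / 4) (1 / 64) := ⟨_, rfl⟩
  have hRout : 0 < Rout := hRouteq ▸ lt_min (by positivity) (by norm_num)
  obtain ⟨Rout', hRout'eq⟩ : ∃ Rout' : ℝ, Rout' = min (h₀q' / 4) (1 / 64) := ⟨_, rfl⟩
  have hRout' : 0 < Rout' := hRout'eq ▸ lt_min (by positivity) (by norm_num)
  obtain ⟨cD, M, hM, hDM⟩ := stub_returnsDie_domainBall D
  obtain ⟨r₁, hr₁, hG⟩ := stub_gate M (μ₀ / 4) Rout hM (by positivity) hRout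
  obtain ⟨r₁', hr₁', hG'⟩ := stub_gate M (μ₀' / 4) Rout' hM (by positivity) hRout'
  exact ⟨dB, dB', c, c₀, μ₀, c', c₁, μ₀', dS, d', h₀q, d'', h₀q', Rout, Rout', r₁, r₁', hdB, hdB',
    hc, hc₀, hc₀eq ▸ min_le_left _ _, hc₀eq ▸ min_le_right _ _, hμ₀, hc', hc₁,
    hc₁eq ▸ min_le_left _ _, hc₁eq ▸ min_le_right _ _, hμ₀', hdS,
    hdSeq ▸ div_le_div_of_nonneg_right hmdB h16, hdSeq ▸ div_le_div_of_nonneg_right hmdB' h16,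
    hdSeq ▸ div_le_div_of_nonneg_right hmμ₀ h16, hdSeq ▸ div_le_div_of_nonneg_right hmμ₀' h16,
    hdSeq ▸ div_le_div_of_nonneg_right hmraP h16, hdSeq ▸ div_le_div_of_nonneg_right hmrbP h16,
    hd', hh₀q, hd'', hd''eq ▸ div_le_div_of_nonneg_right (min_le_left _ _) four_pos.le,
    hd''eq ▸ div_le_div_of_nonneg_right (min_le_right _ _) four_pos.le, hh₀q', hRout,
    hRouteq ▸ min_le_left _ _, hRouteq ▸ min_le_right _ _, hRout', hRout'eq ▸ min_le_left _ _,
    hRout'eq ▸ min_le_right _ _, hr₁, hr₁', hG D φ cD hDM, hG' D.swap φ' cD hDM, hBd, hCont, hInj,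
    hPor, hHt, hBd', hCont', hInj', hHt'⟩

end PathUpgradeRAsm

end Summit.CriticalPhenomena.SAWScalingLimit.Theorems

end
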